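import Summits.QuantumFields.YangMills.Theorems.PoincareLipschitzLatticeToContinuumCoreStep
import Summits.QuantumFields.YangMills.Theorems.PoincareLipschitzLatticeToContinuumSobolevLetters
import HarnessLib

/-!
# LINE 25 «CompactnessTransfer» (K2 crux `BlockLipschitzL` stmt-QuantumFields-23533 ∕ crux of record `HistoryTailL` stmt-QuantumFields-19936), S2♭″ (Γ-KNIT) —
# FILE (K-b) «ENERGY CONVERGENCE FROM ABOVE AT COMPARABLE SCALES»: the last conjunct of S2♭″ from the core step ✓(C), GIVEN the recovery sequences of the
# limit map `U` (the (Γ5) brick's conclusion, taken as a hypothesis on an abstract density `dens`) and the `L²`-convergence of the blow-downs to `U`.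
# With `r := r₀`, `ρ := ⌈rR⌉`, the shell `[2ρ, 19rR∕4]` cut into `N` layers of thickness `h = ⌊rR∕(2N)⌋`, and the recovery map at `(s, s′) = (19r∕4, 5r)`:
# `E_{u_k}(Q_{2ρ}(z_k)) ≤ R_k·(∫_{Q_{5r}} dens + η)` for all large `k`.

Cell `ym3-torus` (YM ladder rung R3 = continuum SU(2) Yang–Mills on T³ — a RUNG, NOT the Clay problem: not d = 4, not infinite volume, not a mass gap);
width seat `ym3-torus-px3` gen 8 (the Γ-KNIT pen, LEAD ★w1-19936 g10 12:29:32Z S2♭″ ARCHITECTURE v0).  THEOREMS ONLY (0 `def`, 0 `sorry`, default heartbeats);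
`--supports stmt-QuantumFields-23533 --as helper`.
HONEST SCOPE.  One half of the knit (K-b); S2♭″ itself, S1″, `hHalvingBand`, K1, `MeanDeviationL`, `BlockLipschitzL`, `HistoryTailL` are NOT proved here; YM gap NOT proved.

References: S. Luckhaus, Indiana Univ. Math. J. 37 (1988) 349–367, Thm 2 (energy convergence of minimising sequences) [Luckhaus1988]; L. Simon, Theorems on
Regularity and Singularity of Energy Minimizing Maps (1996) §2.9 Lemma 1 [Simon1996].
-/

set_option autoImplicit false

noncomputable section

open scoped BigOperators
open MeasureTheory Set Finset Filter Topology

namespace Summit.QuantumFields.YangMills.Theorems.PoincareLipschitzLatticeToContinuumEnergyConvergence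

open Literature.MathematicalPhysics.QuantumFieldTheory.Balaban1983to89
open B4Eq19LatticeOperators (Zd box unitVec mem_box box_mono)
open Summit.QuantumFields.YangMills.Theorems.PoincareLipschitzBlowDownCells (measurable_comp_floorVec)
open Summit.QuantumFields.YangMills.Theorems.PoincareLipschitzSamplingCells (isOpen_absCube)
open Summit.QuantumFields.YangMills.Theorems.PoincareLipschitzLatticeToContinuumLatticeLetters
open Summit.QuantumFields.YangMills.Theorems.PoincareLipschitzLatticeToContinuumCellLetters
open Summit.QuantumFields.YangMills.Theorems.PoincareLipschitzLatticeToContinuumSobolevLetters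
open Summit.QuantumFields.YangMills.Theorems.PoincareLipschitzLatticeToContinuumCoreStep

set_option maxHeartbeats 400000 in
/-- ★★★ **(K-b) ENERGY CONVERGENCE FROM ABOVE AT COMPARABLE SCALES.**  Let `C ≥ 0` satisfy ✓`exists_glued_competitor_le`'s conclusion; let `(u k, z k, R k)` be
S2♭″'s almost-minimising unit lattice sequence (`R k ≥ k+1`, slack `(ρ+1)∕(k+1)`, `E ≤ Λ₀R`), `φ` strictly increasing, `U` a measurable everywhere-unit map with
`∫_Q ‖u(φk)(z(φk) + ⌊R(φk)x⌋) − U x‖² → 0`, and `dens` a density admitting, for `U`, unit lattice RECOVERY MAPS at every `(s, s′, η′)` (the (Γ5) brick's conclusion).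
Then for all `0 < r₀ ≤ 1∕8`, `η > 0` there are `r ∈ [r₀∕2, r₀]` (namely `r₀`) and `k₀` such that for `k ≥ k₀` some integer `ρ ∈ [rR(φk), 2rR(φk)]` has
`E_{u(φk)}(Q_{2ρ}(z(φk))) ≤ R(φk)·(∫_{Q_{5r}} dens + η)`. [cite: Luckhaus1988, Thm 2; Simon1996, §2.9 Lemma 1] -/
theorem energy_convergence_from_above {C : ℝ} (hC0 : 0 ≤ C)
    (hC : ∀ (u v : Zd 3 → EuclideanSpace ℝ (Fin 4)) (Z z : Zd 3) (R : ℤ) (δ : ℝ),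
      (∀ y, ‖u y‖ = 1) → (∀ y, ‖v y‖ = 1) → 0 ≤ δ →
      (∀ (z' : Zd 3) (ρ : ℤ), 0 ≤ ρ → box z' (ρ + 1) ⊆ box Z R →
        ∀ w : Zd 3 → EuclideanSpace ℝ (Fin 4), (∀ y, y ∉ box z' ρ → w y = u y) → (∀ y ∈ box z' ρ, ‖w y‖ = 1) →
        ∑ y ∈ box z' (ρ + 1), ∑ μ : Fin 3, ‖u (y + unitVec μ) - u y‖ ^ 2 ≤
        (∑ y ∈ box z' (ρ + 1), ∑ μ : Fin 3, ‖w (y + unitVec μ) - w y‖ ^ 2) + δ * ((ρ : ℝ) + 1)) →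
      ∀ (a h N : ℕ), 1 ≤ h → 0 < N → box z ((a : ℤ) + N * (h + 1)) ⊆ box Z R →
      ∃ ρ₁ : ℕ, a + (h + 1) ≤ ρ₁ ∧ ρ₁ ≤ a + N * (h + 1) ∧
        ∑ y ∈ box z (ρ₁ : ℤ), ∑ μ : Fin 3, ‖u (y + unitVec μ) - u y‖ ^ 2 ≤
          (∑ y ∈ box z ((ρ₁ : ℤ) - h - 1), ∑ μ : Fin 3, ‖v (y + unitVec μ) - v y‖ ^ 2) +
          C * ((N : ℝ)⁻¹ * (∑ y ∈ box z ((a : ℤ) + N * (h + 1)), ∑ μ : Fin 3,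
                  (‖u (y + unitVec μ) - u y‖ ^ 2 + ‖v (y + unitVec μ) - v y‖ ^ 2)) +
               ((h : ℝ)⁻¹) ^ 2 * (3 * ∑ y ∈ box z ((a : ℤ) + N * (h + 1)) \ box z (a : ℤ), ‖u y - v y‖ ^ 2)) +
          δ * ρ₁)
    {Λ₀ : ℝ}
    (u : ℕ → Zd 3 → EuclideanSpace ℝ (Fin 4)) (z : ℕ → Zd 3) (R : ℕ → ℤ)
    (hR : ∀ k : ℕ, (k : ℝ) + 1 ≤ R k) (hu : ∀ (k : ℕ) (y : Zd 3), ‖u k y‖ = 1)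
    (hmin : ∀ k : ℕ, (∀ (z' : Zd 3) (ρ : ℤ), 0 ≤ ρ → box z' (ρ + 1) ⊆ box (z k) (R k) →
        ∀ v : Zd 3 → EuclideanSpace ℝ (Fin 4), (∀ y, y ∉ box z' ρ → v y = (u k) y) → (∀ y ∈ box z' ρ, ‖v y‖ = 1) →
        ∑ y ∈ box z' (ρ + 1), ∑ μ : Fin 3, ‖(u k) (y + unitVec μ) - (u k) y‖ ^ 2 ≤
        (∑ y ∈ box z' (ρ + 1), ∑ μ : Fin 3, ‖v (y + unitVec μ) - v y‖ ^ 2) + (1 / ((k : ℝ) + 1)) * ((ρ : ℝ) + 1)))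
    (hE : ∀ k : ℕ, ∑ y ∈ box (z k) (R k), ∑ μ : Fin 3, ‖(u k) (y + unitVec μ) - (u k) y‖ ^ 2 ≤ Λ₀ * R k)
    (φ : ℕ → ℕ) (hφ : StrictMono φ)
    (U : EuclideanSpace ℝ (Fin 3) → EuclideanSpace ℝ (Fin 4)) (hUm : Measurable U) (hU1 : ∀ x, ‖U x‖ = 1)
    (hconv : Tendsto (fun k : ℕ => ∫ x in {x : EuclideanSpace ℝ (Fin 3) | ∀ i : Fin 3, |x i| < 1},
        ‖u (φ k) (z (φ k) + fun i => ⌊(R (φ k) : ℝ) * x i⌋) - U x‖ ^ 2) atTop (𝓝 0))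
    (dens : EuclideanSpace ℝ (Fin 3) → ℝ)
    (hrec : ∀ (s s' η : ℝ), 0 < s → s < s' → s' < 1 → 0 < η → ∃ R₀ : ℕ, ∀ Rn : ℕ, R₀ ≤ Rn →
        ∃ v : Zd 3 → EuclideanSpace ℝ (Fin 4), (∀ y, ‖v y‖ = 1) ∧
          (Rn : ℝ)⁻¹ * ∑ y ∈ box (0 : Zd 3) ⌊s * Rn⌋, ∑ μ : Fin 3, ‖v (y + unitVec μ) - v y‖ ^ 2 ≤
            (∫ x in {x : EuclideanSpace ℝ (Fin 3) | ∀ i : Fin 3, |x i| < s'}, dens x) + η ∧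
          ∫ x in {x : EuclideanSpace ℝ (Fin 3) | ∀ i : Fin 3, |x i| < s}, ‖v (fun i => ⌊(Rn : ℝ) * x i⌋) - U x‖ ^ 2 ≤ η) :
    ∀ (r₀ η : ℝ), 0 < r₀ → r₀ ≤ 1 / 8 → 0 < η → ∃ r : ℝ, r₀ / 2 ≤ r ∧ r ≤ r₀ ∧ ∃ k₀ : ℕ, ∀ k : ℕ, k₀ ≤ k →
        ∃ ρ : ℤ, r * (R (φ k) : ℝ) ≤ ρ ∧ (ρ : ℝ) ≤ 2 * r * R (φ k) ∧
        ∑ y ∈ box (z (φ k)) (2 * ρ), ∑ μ : Fin 3, ‖(u (φ k)) (y + unitVec μ) - (u (φ k)) y‖ ^ 2 ≤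
          (R (φ k) : ℝ) * ((∫ x in {x : EuclideanSpace ℝ (Fin 3) | ∀ i : Fin 3, |x i| < (5 * r)}, dens x) + η) := by
  intro r₀ η hr₀ hr₀8 hη
  refine ⟨r₀, by linarith, le_rfl, ?_⟩
  -- names: `r = r₀`, `s = 19r/4 < s' = 5r`, the limit energy `I` on `Q_{5r}`
  set r : ℝ := r₀ with hr_def
  set s : ℝ := 19 * r / 4 with hs_def
  set I : ℝ := ∫ x in {x : EuclideanSpace ℝ (Fin 3) | ∀ i : Fin 3, |x i| < (5 * r)}, dens x with hI_def
  have hr : 0 < r := hr₀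
  have hs0 : 0 < s := by positivity
  have hss' : s < 5 * r := by rw [hs_def]; linarith
  have hs'1 : 5 * r < 1 := by linarith
  have hs1 : s ≤ 1 := by linarith
  -- the number of layers `N`, the thickness fraction `c₁`, the tolerance `η'`
  set N : ℕ := ⌈4 * C * (Λ₀ + |I| + 1) / η⌉₊ + 1 with hN_def
  have hN : 0 < N := Nat.succ_pos _
  have hNr : (0 : ℝ) < N := by exact_mod_cast hN
  have hNge : 4 * C * (Λ₀ + |I| + 1) / η ≤ N := by
    rw [hN_def]; push_cast
    exact (Nat.le_ceil _).trans (by linarith)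
  set c₁ : ℝ := r / (4 * N) with hc₁_def
  have hc₁ : 0 < c₁ := by positivity
  set η' : ℝ := min (min (η / 8) 1) (η * c₁ ^ 2 / (48 * (C + 1))) with hη'_def
  have hη' : 0 < η' := by positivity
  have hη'1 : η' ≤ η / 8 := (min_le_left _ _).trans (min_le_left _ _)
  have hη'2 : η' ≤ 1 := (min_le_left _ _).trans (min_le_right _ _)
  have hη'3 : η' ≤ η * c₁ ^ 2 / (48 * (C + 1)) := min_le_right _ _
  -- the recovery maps of `U` at `(s, 5r, η')`
  obtain ⟨R₀, hR₀⟩ := hrec s (5 * r) η' hs0 hss' hs'1 hη'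
  -- thresholds on `k`
  have hRk : Tendsto (fun k : ℕ => (R (φ k) : ℝ)) atTop atTop := by
    refine tendsto_atTop_mono (fun k => ?_) (tendsto_atTop_add_const_right atTop (1 : ℝ) tendsto_natCast_atTop_atTop)
    have h1 : (k : ℝ) ≤ φ k := by exact_mod_cast hφ.id_le k
    linarith [hR (φ k)]
  have hT1 : ∀ᶠ k : ℕ in atTop, (R₀ : ℝ) ≤ R (φ k) := hRk.eventually_ge_atTop _
  have hT2 : ∀ᶠ k : ℕ in atTop, (4 * N + 4) / r ≤ (R (φ k) : ℝ) := hRk.eventually_ge_atTop _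
  have hT3 : ∀ᶠ k : ℕ in atTop, ∫ x in {x : EuclideanSpace ℝ (Fin 3) | ∀ i : Fin 3, |x i| < 1},
      ‖u (φ k) (z (φ k) + fun i => ⌊(R (φ k) : ℝ) * x i⌋) - U x‖ ^ 2 < η' := hconv.eventually (eventually_lt_nhds hη')
  have hT4 : ∀ᶠ k : ℕ in atTop, 8 / η ≤ (k : ℝ) + 1 :=
    (tendsto_atTop_add_const_right atTop (1 : ℝ) tendsto_natCast_atTop_atTop).eventually_ge_atTop _
  obtain ⟨k₀, hk₀⟩ := eventually_atTop.1 (hT1.and (hT2.and (hT3.and hT4)))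
  refine ⟨k₀, fun k hk => ?_⟩
  obtain ⟨hk1, hk2, hk3, hk4⟩ := hk₀ k hk
  -- the scale at level `k`
  set Rz : ℤ := R (φ k) with hRz
  set Rr : ℝ := (Rz : ℝ) with hRr_def
  have hRr1 : (1 : ℝ) ≤ Rr := by
    have := hR (φ k); have h0 : (0:ℝ) ≤ (φ k : ℝ) := Nat.cast_nonneg _
    rw [hRr_def, hRz]; linarith
  have hRr : 0 < Rr := by linarith
  have hRzpos : (0 : ℤ) < Rz := by
    have h0 : (0 : ℝ) < (Rz : ℝ) := by rw [← hRr_def]; exact hRr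
    exact_mod_cast h0
  have hRz0 : (0 : ℤ) ≤ Rz := hRzpos.le
  set Rn : ℕ := Rz.toNat with hRn
  have hRn_eq : (Rn : ℝ) = Rr := by
    rw [hRr_def, ← Int.cast_natCast, hRn, Int.toNat_of_nonneg hRz0]
  have hRn0 : R₀ ≤ Rn := by exact_mod_cast (hk1.trans_eq hRn_eq.symm)
  -- geometry numbers: `rRr ≥ 4N + 4`
  have hrR : 4 * (N : ℝ) + 4 ≤ r * Rr := by
    have := hk2; rw [div_le_iff₀ hr] at this; linarith
  -- the recovery map at this scale
  obtain ⟨v, hv1, hvE, hvL2⟩ := hR₀ Rn hRn0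
  rw [hRn_eq] at hvE hvL2
  -- `ρ = ⌈rR⌉`, `a = 2ρ`, `h = ⌊rR/(2N)⌋`
  set ρ : ℤ := ⌈r * Rr⌉ with hρ_def
  have hρlo : r * Rr ≤ ρ := Int.le_ceil _
  have hρhi : (ρ : ℝ) ≤ r * Rr + 1 := (Int.ceil_lt_add_one _).le
  have hrRr : 0 < r * Rr := mul_pos hr hRr
  have hρ0 : (0 : ℤ) ≤ ρ := by
    have : (0 : ℝ) ≤ (ρ : ℝ) := hrRr.le.trans hρlo
    exact_mod_cast this
  set a : ℕ := (2 * ρ).toNat with ha_def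
  have ha_eq : (a : ℤ) = 2 * ρ := by rw [ha_def, Int.toNat_of_nonneg (by linarith)]
  have ha_eqr : (a : ℝ) = 2 * ρ := by exact_mod_cast ha_eq
  set h : ℕ := ⌊r * Rr / (2 * N)⌋₊ with hh_def
  have hharg : 2 ≤ r * Rr / (2 * N) := by rw [le_div_iff₀ (by positivity)]; linarith
  have hh2 : 2 ≤ h := by
    rw [hh_def]; exact Nat.le_floor (by exact_mod_cast hharg)
  have hh1 : 1 ≤ h := le_trans (by norm_num) hh2
  have hhr : (h : ℝ) ≤ r * Rr / (2 * N) := Nat.floor_le (by positivity)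
  have hhlo : c₁ * Rr ≤ h := by
    have h1 : r * Rr / (2 * N) - 1 < h := by
      have := Nat.sub_one_lt_floor (r * Rr / (2 * N)); rw [hh_def]; exact this
    have h2 : c₁ * Rr = r * Rr / (2 * N) - r * Rr / (4 * N) := by rw [hc₁_def]; field_simp; ring
    have h3 : 1 ≤ r * Rr / (4 * N) := by rw [le_div_iff₀ (by positivity)]; linarith
    linarith
  have hhpos : (0 : ℝ) < h := by exact_mod_cast (Nat.one_pos.trans_le hh1 : 0 < h)
  -- the shell fits below `sR`
  have htop : ((a + N * (h + 1) : ℕ) : ℝ) + 1 ≤ s * Rr := by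
    push_cast
    rw [ha_eqr]
    have hNh : (N : ℝ) * h ≤ r * Rr / 2 := by
      have := mul_le_mul_of_nonneg_left hhr hNr.le
      have h2 : (N : ℝ) * (r * Rr / (2 * N)) = r * Rr / 2 := by field_simp
      linarith
    have hexp : (N : ℝ) * ((h : ℝ) + 1) = N * h + N := by ring
    have hsR : s * Rr = 19 * (r * Rr) / 4 := by rw [hs_def]; ring
    rw [hexp, hsR]
    linarith
  -- the control set `A = Q_s`
  have hA : MeasurableSet {x : EuclideanSpace ℝ (Fin 3) | ∀ i : Fin 3, |x i| < s} := (isOpen_absCube s).measurableSet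
  have hAfin := volume_absCube_lt_top s
  have hbd_meas : Measurable fun x : EuclideanSpace ℝ (Fin 3) => u (φ k) (z (φ k) + fun i => ⌊Rr * x i⌋) :=
    measurable_comp_floorVec (fun y => u (φ k) (z (φ k) + y)) Rr
  have hvd_meas : Measurable fun x : EuclideanSpace ℝ (Fin 3) => v (fun i => ⌊Rr * x i⌋) := measurable_comp_floorVec v Rr
  have hintU : IntegrableOn (fun x => ‖u (φ k) (z (φ k) + fun i => ⌊Rr * x i⌋) - U x‖ ^ 2)
      {x : EuclideanSpace ℝ (Fin 3) | ∀ i : Fin 3, |x i| < s} volume :=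
    integrableOn_normSq_sub_of_bound hAfin hbd_meas.aestronglyMeasurable hUm.aestronglyMeasurable
      (fun x => (hu _ _).le) (Eventually.of_forall fun x => (hU1 x).le)
  have hintV : IntegrableOn (fun x => ‖v (fun i => ⌊Rr * x i⌋) - U x‖ ^ 2)
      {x : EuclideanSpace ℝ (Fin 3) | ∀ i : Fin 3, |x i| < s} volume :=
    integrableOn_normSq_sub_of_bound hAfin hvd_meas.aestronglyMeasurable hUm.aestronglyMeasurable
      (fun x => (hv1 _).le) (Eventually.of_forall fun x => (hU1 x).le)
  -- `∫_{Q_s} ‖blow-down − U‖² ≤ ∫_Q ≤ η'`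
  have hintU1 : IntegrableOn (fun x => ‖u (φ k) (z (φ k) + fun i => ⌊Rr * x i⌋) - U x‖ ^ 2)
      {x : EuclideanSpace ℝ (Fin 3) | ∀ i : Fin 3, |x i| < 1} volume :=
    integrableOn_normSq_sub_of_bound (volume_absCube_lt_top 1) hbd_meas.aestronglyMeasurable hUm.aestronglyMeasurable
      (fun x => (hu _ _).le) (Eventually.of_forall fun x => (hU1 x).le)
  have heU : ∫ x in {x : EuclideanSpace ℝ (Fin 3) | ∀ i : Fin 3, |x i| < s}, ‖u (φ k) (z (φ k) + fun i => ⌊Rr * x i⌋) - U x‖ ^ 2 ≤ η' := by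
    refine (setIntegral_mono_set hintU1 (Eventually.of_forall fun x => by positivity)
      (Eventually.of_forall fun x hx i => (hx i).trans_le hs1)).trans hk3.le
  -- the cells of the shell lie in `Q_s`
  have hcells : ∀ y ∈ box (z (φ k)) ((a : ℤ) + N * (h + 1)) \ box (z (φ k)) (a : ℤ),
      {x : EuclideanSpace ℝ (Fin 3) | ∀ i, ⌊Rr * x i⌋ = y i - z (φ k) i} ⊆ {x | ∀ i : Fin 3, |x i| < s} := by
    intro y hy x hx
    rw [Finset.mem_sdiff] at hy
    have ha0 : (0 : ℤ) ≤ (a : ℤ) := by positivity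
    have hsh := floorCell_subset_shell hRr ha0 hy.1 hy.2 hx
    intro i
    refine (hsh.1 i).trans_le ?_
    rw [div_le_iff₀ hRr]
    have : (((a : ℤ) + N * (h + 1) : ℤ) : ℝ) + 1 = ((a + N * (h + 1) : ℕ) : ℝ) + 1 := by push_cast; ring
    linarith
  -- THE CORE STEP
  have hδ : (0 : ℝ) ≤ 1 / ((φ k : ℝ) + 1) := by positivity
  have core := core_step hC0 hC (u (φ k)) v (hu (φ k)) hv1 (z (φ k)) (R := Rz) hRzpos hδ (hmin (φ k)) (hE (φ k))
    hs1 hvE U U hA hAfin (fun x _ => rfl) hintU hintV heU hvL2 a h N hh1 hN htop hcells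
  -- bookkeeping
  have h1rR : 1 ≤ r * Rr := by linarith [hrR, hNr]
  refine ⟨ρ, hρlo, by linarith, ?_⟩
  rw [← ha_eq]
  refine core.trans ?_
  -- (i) `B₂ = I + η' ≤ |I| + 1` and the layer term
  have hB : I + η' ≤ |I| + 1 := by linarith [le_abs_self I]
  have hlayer : C * ((N : ℝ)⁻¹ * (Λ₀ * Rr + Rr * (I + η'))) ≤ Rr * (η / 4) := by
    have h1 : C * ((N : ℝ)⁻¹ * (Λ₀ * Rr + Rr * (I + η'))) = Rr * (C * (Λ₀ + (I + η')) / N) := by field_simp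
    rw [h1]
    refine mul_le_mul_of_nonneg_left ?_ hRr.le
    have h2 : C * (Λ₀ + (I + η')) ≤ C * (Λ₀ + |I| + 1) := mul_le_mul_of_nonneg_left (by linarith) hC0
    have h3 : C * (Λ₀ + |I| + 1) / N ≤ η / 4 := by
      rw [div_le_iff₀ hNr]
      have := hNge; rw [div_le_iff₀ hη] at this; linarith
    exact (div_le_div_of_nonneg_right h2 hNr.le).trans h3
  -- (ii) the mismatch term
  have hmis : C * (((h : ℝ)⁻¹) ^ 2 * (3 * (Rr ^ 3 * (2 * (η' + η'))))) ≤ Rr * (η / 4) := by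
    have h1 : ((h : ℝ)⁻¹) ^ 2 ≤ ((c₁ * Rr)⁻¹) ^ 2 := by
      have : (c₁ * Rr)⁻¹ ≥ (h : ℝ)⁻¹ := by
        rw [ge_iff_le, inv_le_inv₀ hhpos (by positivity)]; exact hhlo
      exact pow_le_pow_left₀ (by positivity) this 2
    have h2 : C * (((h : ℝ)⁻¹) ^ 2 * (3 * (Rr ^ 3 * (2 * (η' + η'))))) ≤ C * (((c₁ * Rr)⁻¹) ^ 2 * (3 * (Rr ^ 3 * (2 * (η' + η'))))) :=
      mul_le_mul_of_nonneg_left (mul_le_mul_of_nonneg_right h1 (by positivity)) hC0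
    refine h2.trans ?_
    have h3 : C * (((c₁ * Rr)⁻¹) ^ 2 * (3 * (Rr ^ 3 * (2 * (η' + η'))))) = Rr * (12 * C * η' / c₁ ^ 2) := by
      field_simp; ring
    rw [h3]
    refine mul_le_mul_of_nonneg_left ?_ hRr.le
    rw [div_le_iff₀ (by positivity)]
    have h4 := hη'3; rw [le_div_iff₀ (by positivity)] at h4
    have h5 : 12 * C * η' ≤ 12 * (C + 1) * η' := by
      have := mul_le_mul_of_nonneg_right (by linarith : 12 * C ≤ 12 * (C + 1)) hη'.le
      linarith
    calc 12 * C * η' ≤ 12 * (C + 1) * η' := h5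
      _ = η' * (48 * (C + 1)) / 4 := by ring
      _ ≤ η * c₁ ^ 2 / 4 := div_le_div_of_nonneg_right h4 (by norm_num)
      _ = η / 4 * c₁ ^ 2 := by ring
  -- (iii) the slack
  have hslack : 1 / ((φ k : ℝ) + 1) * (((a : ℕ) : ℝ) + N * (h + 1)) ≤ Rr * (η / 8) := by
    have h1 : ((a : ℕ) : ℝ) + N * (h + 1) ≤ Rr := by
      have h0 : ((a + N * (h + 1) : ℕ) : ℝ) + 1 ≤ s * Rr := htop
      push_cast at h0
      have : s * Rr ≤ Rr := mul_le_of_le_one_left hRr.le hs1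
      linarith
    have h2 : 1 / ((φ k : ℝ) + 1) ≤ η / 8 := by
      have hφk : (k : ℝ) ≤ φ k := by exact_mod_cast hφ.id_le k
      rw [div_le_iff₀ (by positivity)]
      have h3 := hk4; rw [div_le_iff₀ hη] at h3
      have h4 : η * ((k : ℝ) + 1) ≤ η * ((φ k : ℝ) + 1) := mul_le_mul_of_nonneg_left (by linarith) hη.le
      linarith
    calc 1 / ((φ k : ℝ) + 1) * (((a : ℕ) : ℝ) + N * (h + 1)) ≤ (η / 8) * Rr :=
          mul_le_mul h2 h1 (by positivity) (by positivity)
      _ = Rr * (η / 8) := mul_comm _ _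
  have hmain : Rr * (I + η') ≤ Rr * I + Rr * (η / 8) := by
    have := mul_le_mul_of_nonneg_left hη'1 hRr.le
    rw [mul_add]; linarith
  have hRη : 0 < Rr * η := mul_pos hRr hη
  rw [mul_add C] at core ⊢
  linarith [hlayer, hmis, hslack, hmain, hRη]

end Summit.QuantumFields.YangMills.Theorems.PoincareLipschitzLatticeToContinuumEnergyConvergence

end
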